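import Literature.NumberTheory.EllipticCurves.DualExpEllipticRangeOfTateReciprocity
import Literature.NumberTheory.EllipticCurves.PadicLogFiniteExtensionLocalFieldProofs
import Literature.NumberTheory.EllipticCurves.WeilPairingTorsionMulTowerProofs
import Literature.NumberTheory.PAdicHodge.DualExpEllipticLogTraceNondegenerate
import HarnessLib

/-!
# Kato's explicit reciprocity law for `V_pE` — `⟨[η], κ(P)⟩ = Tr_{F/ℚ_p}(c · exp*_ω(η) · log_ω P)` — as the ONE
# printed input of (S5b) / hT₂, and the reductions (S5b) ⟸ [REC], hT₂ ⟸ [REC-tower] in kernel form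

Topic `NumberTheory/EllipticCurves`; namespace `Literature.NumberTheory.EllipticCurves`. Two named facts (closed
`def … : Prop`, cite-tagged, D-0014) and two theorems; no instance, no `sorry`.

Context: crux K★ `stmt-BirchSwinnertonDyer-22226` (route EdixhovenFibreFiveSeven, line `kato_lever`), whose stub hT₂ is
the cite-only fact `PAdicHodge.exists_smul_range_expStarCoord_tower_iff_trace_log` (`DualExpEllipticTower.lean`;
Kato II Thm. 1.4.1 + BK90 Prop. 3.8 / Ex. 3.11 at two levels of a tower), and the 40-odd W2 consumers of its one-level
twin (S5b) `PAdicHodge.exists_smul_range_expStarCoord_iff_trace_log` (`DualExpElliptic.lean`). The hT₂ programme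
(memo `Summits/…/Cruxes/StarredOptimalManinUnitFiveSeven/Lines/kato-lever-hT2-programme.md`) dissected these facts into
[REC] + [TD] + [N] + [ADD] and PROVED everything but [REC]:
* the assembly `PAdicHodge.range_expStarCoord_smul_iff_of_reciprocity` / `PAdicHodge.exists_smul_range_tower_of_reciprocity`
  (`DualExpEllipticOfReciprocity.lean`);
* [TD] `exists_contOneCocycles_tatePairingPoint_eq` / `exists_contOneCocycles_tatePairingPointTower_eq` for THE pairing of
  the tree — the `ℤ_p`-valued local Tate pairing with the Kummer image `tatePairingPoint` (`LocalTatePairingPoints.lean`,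
  `LocalTateDualityPoints.lean`, `DualExpEllipticRangeOfTateReciprocity.lean`);
* [N] `PAdicHodge.eq_zero_of_forall_trace_mul_padicLog_baseChange_eq_zero` (`DualExpEllipticLogTraceNondegenerate.lean`);
* [ADD] `FormalGroupChart.padicLogPointFiniteExt_baseChange_add` (`PadicLogFiniteExtensionLocalFieldProofs.lean`);
* the Weil-tower binders: `WeierstrassCurve.exists_weilPairing_torsionMul_tower` (`WeilPairingTorsionMulTowerProofs.lean`).

This file names the remaining printed input and performs the reduction:

* `tatePairingPoint_eq_trace_expStar_log` — **[REC], one level** (Kato, LNM 1553, Ch. II Thm. 1.4.1 (4) with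
  Lemma 1.4.3–1.4.5: `exp*` is the transpose of the Bloch–Kato exponential under local Tate duality,
  `inv_F(x ∪ exp_{V*(1)}(v)) = Tr_{F/ℚ_p}(exp*_V(x) ∪_dR v)` — Delbourgo 2008 §2.2, the displayed trace formula — read for
  `V = V_pE ≅ V*(1)` (Weil pairing) with BK90 Ex. 3.10.1 / (3.11.1) `κ = exp ∘ log_E` (Delbourgo Ex. 2.5)): for every
  level-compatible tower of Weil pairings `e`, every generator `d` of the Néron line under the Prop-1.2.3 binders, there is
  ONE `c ∈ Fˣ` (the position of `d.ω` against the invariant differential `ω` of the model, and the sign) with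
  `⟨[η], κ(P)⟩_e = Tr_{F/ℚ_p}(c · exp*_d(η) · log_ω P)` in `ℚ_p` for all continuous crossed homomorphisms `η : Γ_F → T_pW`
  and all `P ∈ E(F)`.
* `tatePairingPoint_eq_trace_expStar_log_tower` — **[REC-tower]**: the same at the two levels `F ⊇ F₀` of a tower, for line
  data `d₀ / F₀`, `d / F` compatible under restriction, with ONE constant `c ∈ F₀ˣ` (the scalar at `F` being
  `algebraMap F₀ F c`; Kato II §1.2.4: `exp*` and `[ω]` commute with restriction, so `d = d₀ ⊗ 1` has the same position
  against `ω`) — the pairing at `F` being `tatePairingPointTower` (the tree's pairing transported to the tower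
  representation `(T_pW|_{Γ_{F₀}})|_{Γ_F}`).
* ★ `exists_smul_range_expStarCoord_iff_trace_log_of_reciprocityLaw : [REC] → (S5b)` and
  ★★ `exists_smul_range_expStarCoord_tower_iff_trace_log_of_reciprocityLaw : [REC-tower] → hT₂` — ONE application of the
  assembly, [TD]/[N]/[ADD]/Weil binders discharged by the tree. So the stub `stub_expStarTower` of the K★ skeleton is
  PROVABLE from [REC-tower] alone; the crux's printed inputs become {P1 (Kato 2004), [REC-tower] (Kato 1993 Thm. 1.4.1)}.

READINGS (own attribution, as for (S5b)/hT₂): the identification of the tree's `inv ∘ ∪_{Weil}`-pairing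
`tatePairingPoint` (limit of the level-`p^k` pairings with the unramified `inv_{p^k}`) with Kato's `H¹(F,T) × H¹(F,T*(1)) → ℤ_p`;
`log_ω = FormalGroupChart.padicLogPointFiniteExt` (Silverman IV.6.4 / VII.2.2) as BK's `log_E` in the coordinate `ω`;
the uniformity in the Weil datum `e` (two nondegenerate equivariant compatible towers differ by `φ ∈ Aut_{Γ}(T_pW)`, whose
`D_dR(φ)` acts on the line `t_V` by a scalar of `F`, absorbed in `c`). NOT asserted: the value of `c` or of the sign, anything
for non-de-Rham data (the binders are hypotheses), anything at `ℓ ≠ p`. HONEST SIZE: [REC] is an XL formalisation target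
(Bloch–Kato's `exp`, Kato II Lemma 1.4.3 — a cup-product computation with `B⁺_dR`-coefficients — and the explicit reciprocity
law of `𝔾_m`, Lemma 1.4.4–1.4.5 `inv(δ(a · log χ_cyc)) = −Tr_{F/ℚ_p}(a)`); it is NOT proved here. BSD / K★ are not proved by
any of this.

## References
* K. Kato, *Lectures on the approach to Iwasawa theory for Hasse–Weil L-functions via B_dR, Part I*, LNM 1553 (1993),
  Ch. II §1.2.4, Prop. 1.2.3, Thm. 1.4.1 (3)–(4), Lemma 1.4.3–1.4.5. [Kato1993LNM1553]
* S. Bloch, K. Kato, *L-functions and Tamagawa numbers of motives* (1990), Prop. 3.8, Def. 3.10, Ex. 3.10.1,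
  Example 3.11 (3.11.1). [BlochKato1990]
* D. Delbourgo, *Elliptic Curves and Big Galois Representations* (2008), §2.2: Ex. 2.5 and the trace formula
  `Tr_{K/ℚ_p}(exp*_{K,V}(x) ∪_dR v mod Fil⁰) = inv_K(x ∪ exp_{K,V*(1)}(v))` (PDF p. 45 of the held copy). [Delbourgo2008]
* J. H. Silverman, *AEC* (2009), III.§8 (Weil pairing), Thm. IV.6.4 with Prop. VII.2.2 (`log_ω`). [SilvermanAEC2009]
-/

noncomputable section

open scoped Classical NNReal
open CategoryTheory Field ValuativeRel
open Literature.NumberTheory.GaloisRepresentations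
open Literature.NumberTheory.GaloisRepresentations.IsNonarchimedeanLocalField
open Literature.NumberTheory.PAdicHodge
open WeierstrassCurve

namespace Literature.NumberTheory.EllipticCurves

/-! ### [REC] — one level -/

/-- **[REC] Kato's explicit reciprocity law for `V_pE` at one `p`-adic field** (Kato, LNM 1553, Ch. II Thm. 1.4.1 (4)
with Lemma 1.4.3–1.4.5 — `exp*` is the transpose of the Bloch–Kato exponential under local Tate duality; Delbourgo's
trace formula `Tr_{F/ℚ_p}(exp*_V(x) ∪_dR v) = inv_F(x ∪ exp_{V*(1)}(v))` — for `V = V_pE ≅ V*(1)` via the Weil pairing,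
combined with Bloch–Kato Ex. 3.10.1 / (3.11.1): the Kummer map is `exp ∘ log_E`). For an elliptic curve `W/K₀`, a
`p`-adic field `F ⊇ K₀` of characteristic `0` with a compatible valuation `w` for which `W ×_{K₀} F` is integral, EVERY
level-compatible tower of Weil pairings `e` on `E[p^k]` (bilinear, `Γ_{K₀}`-equivariant, non-degenerate,
`e_k(pS,pT) = e_{k+1}(S,T)^p`), and — under the Prop-1.2.3 binders — EVERY generator `d.ω` of `D⁰_dR(V_pW|_{Γ_F})`, there
is ONE `c ∈ Fˣ` such that for every continuous crossed homomorphism `η : Γ_F → T_pW` and every `P ∈ E(F)`: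
`⟨[η], κ(P)⟩ = Tr_{F/ℚ_p}(c · exp*_d(η) · log_ω P)` in `ℚ_p`, where `⟨·, ·⟩ = tatePairingPoint …` is the tree's `ℤ_p`-valued
local Tate pairing with the Kummer image (`inv_F(x ∪_{e} κ P)`, limit of the level-`p^k` pairings), `exp*_d = expStarCoord`
(Kato's dual exponential in the coordinate `d.ω`) and `log_ω = FormalGroupChart.padicLogPointFiniteExt w (W.baseChange F) p`.
(`c` = the position of `d.ω` against the invariant differential `ω` of the model, and the sign; scale-free in `d`.)
[cite: Kato1993LNM1553, Ch. II Thm. 1.4.1 (3)–(4), Lemma 1.4.3–1.4.5, §1.2.4] [cite: BlochKato1990, Prop. 3.8 (p. 354), Ex. 3.10.1 (p. 359), Example 3.11 (3.11.1) (p. 361)]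
[cite: Delbourgo2008, §2.2 Ex. 2.5 and the trace formula for exp* (PDF p. 45)] [cite: SilvermanAEC2009, III.§8, Thm. IV.6.4 with Prop. VII.2.2] -/
def tatePairingPoint_eq_trace_expStar_log : Prop :=
  ∀ {K₀ : Type} [Field K₀] [CharZero K₀] (W : WeierstrassCurve K₀) [W.IsElliptic]
    {F : Type} [Field F] [Algebra K₀ F] [ValuativeRel F] [TopologicalSpace F]
    [IsNonarchimedeanLocalField F] [CharZero F] {p : ℕ} [Fact p.Prime]
    [Fact (¬ IsUnit (p : integerC F))] [IsAdicComplete (Ideal.span {(p : integerC F)}) (integerC F)]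
    (hp : valuation F p < 1) [Algebra ℚ_[p] F]
    (w : Valuation F ℝ≥0) [w.Compatible] [(W.baseChange F).IsIntegral w.integer]
    -- a level-compatible tower of Weil pairings on `E[p^k]`
    (e : (k : ℕ) → geomTorsion W ((p ^ k : ℕ) : ℤ) → geomTorsion W ((p ^ k : ℕ) : ℤ) → AlgebraicClosure K₀)
    (hμ : ∀ k S T, e k S T ^ (p ^ k) = 1)
    (hadd₁ : ∀ k S₁ S₂ T, e k (S₁ + S₂) T = e k S₁ T * e k S₂ T)
    (hadd₂ : ∀ k S T₁ T₂, e k S (T₁ + T₂) = e k S T₁ * e k S T₂)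
    (hgal : ∀ k (σ : absoluteGaloisGroup K₀) (S T : geomTorsion W ((p ^ k : ℕ) : ℤ)),
      σ • e k S T = e k (σ • S) (σ • T))
    (_hnondeg : ∀ k (T : geomTorsion W ((p ^ k : ℕ) : ℤ)), (∀ S, e k S T = 1) → T = 0)
    (hcompat : ∀ k (S T : geomTorsion W ((p ^ (k + 1) : ℕ) : ℤ)),
      e k (torsionMulHom W (p ^ (k + 1)) (p ^ k) p (pow_succ p k).symm S)
        (torsionMulHom W (p ^ (k + 1)) (p ^ k) p (pow_succ p k).symm T) = e (k + 1) S T ^ p)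
    -- a generator of the Néron line, under the Prop-1.2.3 binders
    (d : (bdRPeriodRingData (F := F) (p := p) hp).FilZeroLine (restrictedRationalTateRep W F p)),
    (bdRPeriodRingData hp).CupLogInjective (logCyclotomic p) (restrictedRationalTateRep W F p) →
    (∀ z : contOneCocycles (restrictedRationalTateRep W F p).toTopRep,
      (bdRPeriodRingData hp).HasDualExp (logCyclotomic p) (restrictedRationalTateRep W F p) fun σ => z.1 σ) →
    ∃ c : F, c ≠ 0 ∧
      ∀ (η : contOneCocycles (restrictedTateRep W F p).toTopRep) (P : (W.baseChange F).toAffine.Point),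
        ((tatePairingPoint W F p e hμ hadd₁ hadd₂ hgal hcompat (oneCocycleClass _ η) P : ℤ_[p]) : ℚ_[p]) =
          Algebra.trace ℚ_[p] F
            (c * expStarCoord W hp d η * FormalGroupChart.padicLogPointFiniteExt w (W.baseChange F) p P)

/-! ### [REC-tower] — two levels, one constant -/

/-- **[REC-tower] Kato's explicit reciprocity law for `V_pE` at the two levels of a tower `F ⊇ F₀ ⊇ K₀`, with ONE
constant.** Setting of hT₂ (`PAdicHodge.exists_smul_range_expStarCoord_tower_iff_trace_log`) verbatim: `W/K₀` elliptic,
`p`-adic fields `F₀ ⊆ F` of characteristic `0` with compatible valuations `w₀`, `w` for which the models are integral, a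
level-compatible tower of Weil pairings `e`, line data `d₀` of `D⁰_dR(V_pW|_{Γ_{F₀}})` and `d` of `D⁰_dR` of the tower
representation `(V_pW|_{Γ_{F₀}})|_{Γ_F}` under the Prop-1.2.3 binders at both levels and COMPATIBLE under restriction
(`exp*_d(η₀ ∘ res) = (F₀ → F)(exp*_{d₀}(η₀))`). Then there is ONE `c ∈ F₀ˣ` with
`⟨[η₀], κ(P₀)⟩ = Tr_{F₀/ℚ_p}(c · exp*_{d₀}(η₀) · log_ω P₀)` for all `η₀ : Γ_{F₀} → T_pW`, `P₀ ∈ E(F₀)`, AND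
`⟨[η], κ(P)⟩ = Tr_{F/ℚ_p}(c · exp*_d(η) · log_ω P)` for all `η : Γ_F → T_pW` (tower representation; the pairing is
`tatePairingPointTower`, the tree's pairing over `F` transported along `T_pW|_{Γ_F} ≅ (T_pW|_{Γ_{F₀}})|_{Γ_F}`), `P ∈ E(F)`.
Chain: Kato II Thm. 1.4.1 (4) with Lemma 1.4.3–1.4.5 at `F₀` and at `F`, and §1.2.4 (functoriality of `exp*` and of
`[ω] ∈ D_dR` under restriction: compatible line data have the same position against `ω`, `exp*_{d₀} ≠ 0`); BK90
Ex. 3.10.1 / (3.11.1); Delbourgo §2.2. [cite: Kato1993LNM1553, Ch. II Thm. 1.4.1 (3)–(4), Lemma 1.4.3–1.4.5 and §1.2.4]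
[cite: BlochKato1990, Prop. 3.8 (p. 354), Ex. 3.10.1 (p. 359), Example 3.11 (3.11.1) (p. 361)]
[cite: Delbourgo2008, §2.2 Ex. 2.5 and the trace formula for exp* (PDF p. 45)] [cite: SilvermanAEC2009, III.§8, Thm. IV.6.4 with Prop. VII.2.2] -/
def tatePairingPoint_eq_trace_expStar_log_tower : Prop :=
  ∀ {K₀ : Type} [Field K₀] [CharZero K₀] (W : WeierstrassCurve K₀) [W.IsElliptic]
    -- the lower field `F₀ ⊇ K₀`
    {F₀ : Type} [Field F₀] [Algebra K₀ F₀] [ValuativeRel F₀] [TopologicalSpace F₀]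
    [IsNonarchimedeanLocalField F₀] [CharZero F₀] {p : ℕ} [Fact p.Prime]
    [Fact (¬ IsUnit (p : integerC F₀))] [IsAdicComplete (Ideal.span {(p : integerC F₀)}) (integerC F₀)]
    (hp₀ : valuation F₀ p < 1) [Algebra ℚ_[p] F₀]
    (w₀ : Valuation F₀ ℝ≥0) [w₀.Compatible] [(W.baseChange F₀).IsIntegral w₀.integer]
    -- the upper field `F ⊇ F₀`
    {F : Type} [Field F] [Algebra K₀ F] [Algebra F₀ F] [IsScalarTower K₀ F₀ F] [ValuativeRel F]
    [TopologicalSpace F] [IsNonarchimedeanLocalField F] [CharZero F]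
    [Fact (¬ IsUnit (p : integerC F))] [IsAdicComplete (Ideal.span {(p : integerC F)}) (integerC F)]
    (hp : valuation F p < 1) [Algebra ℚ_[p] F]
    (w : Valuation F ℝ≥0) [w.Compatible] [(W.baseChange F).IsIntegral w.integer]
    -- a level-compatible tower of Weil pairings on `E[p^k]`
    (e : (k : ℕ) → geomTorsion W ((p ^ k : ℕ) : ℤ) → geomTorsion W ((p ^ k : ℕ) : ℤ) → AlgebraicClosure K₀)
    (hμ : ∀ k S T, e k S T ^ (p ^ k) = 1)
    (hadd₁ : ∀ k S₁ S₂ T, e k (S₁ + S₂) T = e k S₁ T * e k S₂ T)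
    (hadd₂ : ∀ k S T₁ T₂, e k S (T₁ + T₂) = e k S T₁ * e k S T₂)
    (hgal : ∀ k (σ : absoluteGaloisGroup K₀) (S T : geomTorsion W ((p ^ k : ℕ) : ℤ)),
      σ • e k S T = e k (σ • S) (σ • T))
    (_hnondeg : ∀ k (T : geomTorsion W ((p ^ k : ℕ) : ℤ)), (∀ S, e k S T = 1) → T = 0)
    (hcompat : ∀ k (S T : geomTorsion W ((p ^ (k + 1) : ℕ) : ℤ)),
      e k (torsionMulHom W (p ^ (k + 1)) (p ^ k) p (pow_succ p k).symm S)
        (torsionMulHom W (p ^ (k + 1)) (p ^ k) p (pow_succ p k).symm T) = e (k + 1) S T ^ p)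
    -- line data at both levels
    (d₀ : (bdRPeriodRingData (F := F₀) (p := p) hp₀).FilZeroLine (restrictedRationalTateRep W F₀ p))
    (d : (bdRPeriodRingData (F := F) (p := p) hp).FilZeroLine
      ((restrictedRationalTateRep W F₀ p).restrict (absGaloisRestrict F₀ F))),
    -- Prop-1.2.3 binders at both levels
    (bdRPeriodRingData hp₀).CupLogInjective (logCyclotomic p) (restrictedRationalTateRep W F₀ p) →
    (∀ z : contOneCocycles (restrictedRationalTateRep W F₀ p).toTopRep,
      (bdRPeriodRingData hp₀).HasDualExp (logCyclotomic p) (restrictedRationalTateRep W F₀ p) fun σ => z.1 σ) →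
    (bdRPeriodRingData hp).CupLogInjective (logCyclotomic p)
      ((restrictedRationalTateRep W F₀ p).restrict (absGaloisRestrict F₀ F)) →
    (∀ z : contOneCocycles ((restrictedRationalTateRep W F₀ p).restrict (absGaloisRestrict F₀ F)).toTopRep,
      (bdRPeriodRingData hp).HasDualExp (logCyclotomic p)
        ((restrictedRationalTateRep W F₀ p).restrict (absGaloisRestrict F₀ F)) fun σ => z.1 σ) →
    -- compatibility of the line data under restriction (`exp*_d ∘ res = (F₀ → F) ∘ exp*_{d₀}`)
    (∀ (η₀ : contOneCocycles (restrictedTateRep W F₀ p).toTopRep)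
        (η : contOneCocycles ((restrictedTateRep W F₀ p).restrict (absGaloisRestrict F₀ F)).toTopRep),
        (∀ σ, η.1 σ = η₀.1 (absGaloisRestrict F₀ F σ)) →
        expStarCoordTower W hp d η = algebraMap F₀ F (expStarCoord W hp₀ d₀ η₀)) →
    ∃ c : F₀, c ≠ 0 ∧
      (∀ (η₀ : contOneCocycles (restrictedTateRep W F₀ p).toTopRep) (P : (W.baseChange F₀).toAffine.Point),
        ((tatePairingPoint W F₀ p e hμ hadd₁ hadd₂ hgal hcompat (oneCocycleClass _ η₀) P : ℤ_[p]) : ℚ_[p]) =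
          Algebra.trace ℚ_[p] F₀
            (c * expStarCoord W hp₀ d₀ η₀ * FormalGroupChart.padicLogPointFiniteExt w₀ (W.baseChange F₀) p P)) ∧
      (∀ (η : contOneCocycles ((restrictedTateRep W F₀ p).restrict (absGaloisRestrict F₀ F)).toTopRep)
          (P : (W.baseChange F).toAffine.Point),
        ((tatePairingPointTower W F₀ e hμ hadd₁ hadd₂ hgal hcompat (oneCocycleClass _ η) P : ℤ_[p]) : ℚ_[p]) =
          Algebra.trace ℚ_[p] F
            (algebraMap F₀ F c * expStarCoordTower W hp d η *
              FormalGroupChart.padicLogPointFiniteExt w (W.baseChange F) p P))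

/-! ### The reductions -/

/-- `p ≠ 0` in the base field `K₀` of an elliptic curve when `K₀` maps to a field of characteristic `0`. [folklore] -/
private theorem natCast_ne_zero_of_algebra {K₀ : Type} [Field K₀] (F : Type) [Field F] [Algebra K₀ F] [CharZero F]
    {p : ℕ} [Fact p.Prime] : (p : K₀) ≠ 0 := by
  intro h
  apply (Nat.cast_ne_zero.mpr (Fact.out : p.Prime).ne_zero : (p : F) ≠ 0)
  rw [← map_natCast (algebraMap K₀ F), h, map_zero]

/-- ★ **(S5b) ⟸ [REC]**: Kato's reciprocity law at one level implies the cite fact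
`PAdicHodge.exists_smul_range_expStarCoord_iff_trace_log` — ONE application of the assembly
`PAdicHodge.range_expStarCoord_smul_iff_of_reciprocity` (`e = c⁻¹`) with Tate duality [TD]
(`exists_contOneCocycles_tatePairingPoint_eq`), non-degeneracy [N] (`eq_zero_of_forall_trace_mul_padicLog_baseChange_eq_zero`),
additivity [ADD] (`padicLogPointFiniteExt_baseChange_add`) and the Weil tower (`exists_weilPairing_torsionMul_tower`) all THEOREMS
of the tree. [cite: Kato1993LNM1553, Ch. II Thm. 1.4.1 (3)–(4)] [cite: BlochKato1990, Prop. 3.8 (p. 354), Example 3.11 (p. 361)] -/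
theorem exists_smul_range_expStarCoord_iff_trace_log_of_reciprocityLaw (hrec : tatePairingPoint_eq_trace_expStar_log) :
    PAdicHodge.exists_smul_range_expStarCoord_iff_trace_log := by
  intro K₀ _ _ W _ F _ _ _ _ _ _ p _ _ _ hp _ w _ _ d hcli hde
  obtain ⟨e, hμ, hadd₁, hadd₂, hgal, hnondeg, hcompat⟩ :=
    WeierstrassCurve.exists_weilPairing_torsionMul_tower W (natCast_ne_zero_of_algebra F (p := p))
  obtain ⟨c, hc, hrecF⟩ := hrec W hp w e hμ hadd₁ hadd₂ hgal hnondeg hcompat d hcli hde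
  exact ⟨c⁻¹, inv_ne_zero hc, fun a =>
    PAdicHodge.range_expStarCoord_smul_iff_of_reciprocity W hp w d
      (fun η P => tatePairingPoint W F p e hμ hadd₁ hadd₂ hgal hcompat (oneCocycleClass _ η) P) c hc hrecF
      (exists_contOneCocycles_tatePairingPoint_eq W e hμ hadd₁ hadd₂ hgal hnondeg hcompat)
      (fun _ hb => PAdicHodge.eq_zero_of_forall_trace_mul_padicLog_baseChange_eq_zero W hp w hb)
      (FormalGroupChart.padicLogPointFiniteExt_baseChange_add W hp w) a⟩

/-- ★★ **hT₂ ⟸ [REC-tower]**: Kato's reciprocity law at the two levels of a tower (one constant) implies the cite fact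
`PAdicHodge.exists_smul_range_expStarCoord_tower_iff_trace_log` — the stub `stub_expStarTower` of the K★ skeleton
(`Summits/…/Cruxes/StarredOptimalManinUnitFiveSeven/Lines/kato_lever.lean`) — by ONE application of
`PAdicHodge.exists_smul_range_tower_of_reciprocity`, with [TD] at both levels (`exists_contOneCocycles_tatePairingPoint_eq`,
`exists_contOneCocycles_tatePairingPointTower_eq`), [N], [ADD] and the Weil tower discharged by the tree. So the printed
inputs of K★ along the line `kato_lever` are {P1, [REC-tower]}. [cite: Kato1993LNM1553, Ch. II Thm. 1.4.1 (3)–(4) and §1.2.4]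
[cite: BlochKato1990, Prop. 3.8 (p. 354), Example 3.11 (p. 361)] -/
theorem exists_smul_range_expStarCoord_tower_iff_trace_log_of_reciprocityLaw
    (hrec : tatePairingPoint_eq_trace_expStar_log_tower) :
    PAdicHodge.exists_smul_range_expStarCoord_tower_iff_trace_log := by
  intro K₀ _ _ W _ F₀ _ _ _ _ _ _ p _ _ _ hp₀ _ w₀ _ _ F _ _ _ _ _ _ _ _ _ _ hp _ w _ _ d₀ d hcli₀ hde₀ hcli hde hcomp
  obtain ⟨e, hμ, hadd₁, hadd₂, hgal, hnondeg, hcompat⟩ :=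
    WeierstrassCurve.exists_weilPairing_torsionMul_tower W (natCast_ne_zero_of_algebra F₀ (p := p))
  obtain ⟨c, hc, hrec₀, hrecF⟩ :=
    hrec W hp₀ w₀ hp w e hμ hadd₁ hadd₂ hgal hnondeg hcompat d₀ d hcli₀ hde₀ hcli hde hcomp
  exact PAdicHodge.exists_smul_range_tower_of_reciprocity W hp₀ w₀ hp w d₀ d
    (fun η₀ P => tatePairingPoint W F₀ p e hμ hadd₁ hadd₂ hgal hcompat (oneCocycleClass _ η₀) P)
    (fun η P => tatePairingPointTower W F₀ e hμ hadd₁ hadd₂ hgal hcompat (oneCocycleClass _ η) P)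
    c hc hrec₀ hrecF
    (exists_contOneCocycles_tatePairingPoint_eq W e hμ hadd₁ hadd₂ hgal hnondeg hcompat)
    (exists_contOneCocycles_tatePairingPointTower_eq W F₀ e hμ hadd₁ hadd₂ hgal hnondeg hcompat)
    (fun _ hb => PAdicHodge.eq_zero_of_forall_trace_mul_padicLog_baseChange_eq_zero W hp₀ w₀ hb)
    (fun _ hb => PAdicHodge.eq_zero_of_forall_trace_mul_padicLog_baseChange_eq_zero W hp w hb)
    (FormalGroupChart.padicLogPointFiniteExt_baseChange_add W hp₀ w₀)
    (FormalGroupChart.padicLogPointFiniteExt_baseChange_add W hp w)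

end Literature.NumberTheory.EllipticCurves

end
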